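import Summits.QuantumFields.BalabanUV.T4Continuum.Support.NE7AdmissibleFibreQuantitative
import Summits.QuantumFields.BalabanUV.T4Continuum.Support.NE7MinimalOrbitDatumContinuity
import HarnessLib

/-!
# NE7MinimalActionUpperLipschitz — THE MINIMAL ACTION IS UPPER-LIPSCHITZ (CALM FROM ABOVE) IN THE DATUM AT EVERY SMALL DATUM: for every `U(n)`, every `L ≥ 2`, `d = 4`, over the
# small data, at every level `j+1` and every base datum `V₀`: `∃ C ≥ 0`, EVENTUALLY as the unitary `N`-periodic datum `V → V₀`, a constrained minimiser over `V` exists and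
# `A_{j+1}(V) ≤ A_{j+1}(V₀) + C·‖y(V)‖`, `y(V) = skewPR (relLog V₀ V)` the `𝔲(n)` chart coordinate of `V` at `V₀` — the first QUANTITATIVE datum-dependence statement of the
# lineage's background-field theory (gen 113's quantitative admissible fibre `NE7AdmissibleFibreQuantitative` at the (8)∃ interior minimiser)

Cell `pub-balaban`, rung (B)+1 sub-cell t4, lineage `b2b-balaban-t4-ne7-p1` (CRUX PROVER NE7 #1 = OWNER of BINDER row NE7), generation 113.  Memo
`t4/b2b-balaban-t4-ne7-p1-g113/ROAD-G113.md` §6 next (i).  Over gen 113's `NE7AdmissibleFibreQuantitative.admissible_lhc_quantitative`, `NE7MinimalOrbitDatumContinuity.thresholds`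
((8)∃ interior + class smallness) and row NE3's `MinimalActionExistence.exists_isMinimiser_of_nonempty`.
WHAT ([folklore]; 0 def, 0 sorry).  **`minAct_upper_lipschitz`**: `∃ ε₀ > 0, ∀ 0 < ε ≤ ε₀, ∀ N ≥ 1, ∃ δ_V > 0, ∀ V₀ (unitary, N-periodic, SmallField V₀ δ_V), ∀ j, ∃ C ≥ 0, ∀ᶠ V in 𝓝 V₀,
V unitary ∧ N-periodic → (∃ U, IsMinimiser 4 (sfClass 4 L N ε) L N (j+1) V U) ∧ minAct 4 (sfClass 4 L N ε) L N (j+1) V ≤ minAct 4 (sfClass 4 L N ε) L N (j+1) V₀ + C·‖skewPR N (relLog N V₀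
V)‖`.  The LOWER bound with a linear rate (hence Lipschitz continuity of `A_k` and Hölder-½ of the orbit via ✓ p819492's quadratic growth) needs the chart's decoding at the moving
minimiser and the `Stab(V₀)`-covariance of the coordinate — NOT claimed (memo §6 next (i)).
HONEST FRAMING (page 1): soft calculus over landed kernel theorems; `C` existential, NOT uniform in `V₀`, `j`, `N`; nothing of Bałaban's asserted as an axiom and NOT his method;
finite 4-torus, small data; NOT NE7 as a spine node (dagwriter∕referees' call), NOT NE3; spine 0∕9; NOT infinite volume, NOT mass gap, NOT BetaPertH, NOT Clay (continuum YM on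
T⁴ ⇐ BetaPertH ∧ nine spine estimates).
-/

set_option autoImplicit false

open scoped BigOperators Matrix Matrix.Norms.L2Operator Topology
open NormedSpace Finset Set Filter

namespace Summit.QuantumFields.BalabanUV.T4Continuum.NE7MinimalActionUpperLipschitz

open Literature.MathematicalPhysics.QuantumFieldTheory.Balaban1983to89
open B7Prop1Explicit B7Prop2Explicit
open T4AveragingDeficitWall (IsUnitaryCfg SmallField fineAction)
open T4AveragingDeficitWallBoundary (IsPeriodicCfg)
open AveragingDeficitTorusChart (TDir chart)
open AveragingDeficitChartCalculus (relLog)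
open AveragingDeficitTwoLevelPrep (skewSub skewPR)
open AveragingDeficitMultiLevelPrep (tower LevelSmall)
open MinimalActionLevels (perWin levelAction stepWt stepWt_pos)
open MinimalActionSandwich (IsMinimiser admissible minAct)
open MinimalActionRate (sfClass)
open MinimalActionExistence (exists_isMinimiser_of_nonempty)
open NE7AdmissibleFibreLHC (period_succ_eq)
open NE7AdmissibleFibreQuantitative (admissible_lhc_quantitative)
open NE7MinimalOrbitDatumContinuity (thresholds)

noncomputable section

variable {n : Type} [Fintype n] [DecidableEq n]

/-- **THE MINIMAL ACTION IS UPPER-LIPSCHITZ IN THE DATUM, EVERY `U(n)`, EVERY `L ≥ 2`, `d = 4`** (statement in the file header). [folklore] -/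
theorem minAct_upper_lipschitz [Nonempty n] {L : ℕ} (hL : 2 ≤ L) :
    ∃ ε₀ : ℝ, 0 < ε₀ ∧ ∀ ε : ℝ, 0 < ε → ε ≤ ε₀ → ∀ (N : ℕ) [NeZero N], 1 ≤ N →
      ∃ δV : ℝ, 0 < δV ∧
        ∀ V₀ ∈ {V : Site 4 → Fin 4 → (Matrix n n ℂ)ˣ | IsUnitaryCfg V ∧ IsPeriodicCfg V (N : ℤ) ∧ SmallField V δV},
        ∀ j : ℕ, ∃ C : ℝ, 0 ≤ C ∧
          ∀ᶠ V in 𝓝 V₀, IsUnitaryCfg V → IsPeriodicCfg V (N : ℤ) →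
            (∃ U : Site 4 → Fin 4 → (Matrix n n ℂ)ˣ, IsMinimiser 4 (sfClass 4 L N ε) L N (j + 1) V U) ∧
            minAct 4 (sfClass 4 L N ε) L N (j + 1) V ≤ minAct 4 (sfClass 4 L N ε) L N (j + 1) V₀ + C * ‖skewPR N (relLog N V₀ V)‖ := by
  haveI : NeZero L := ⟨by omega⟩
  have hL1 : 1 ≤ L := by omega
  obtain ⟨ε₀, hε₀, H⟩ := thresholds (n := n) hL
  refine ⟨ε₀, hε₀, fun ε hε hεle N _ hN => ?_⟩
  obtain ⟨hε1, hε2, hls, H1⟩ := H ε hε hεle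
  obtain ⟨δ₁, hδ₁, hint₁⟩ := H1 N hN
  refine ⟨δ₁, hδ₁, fun V₀ hV₀ j => ?_⟩
  obtain ⟨Us, hUs, a, -, haε, hUsa⟩ := hint₁ V₀ hV₀ (j + 1)
  -- the quantitative fibre at the interior minimiser, window = the period window
  obtain ⟨κ, C, hκ, hC, hfib⟩ := admissible_lhc_quantitative (d := 4) (n := n) hL1 hε.le (hls j) hUs.mem haε hUsa (perWin 4 (N * L ^ (j + 1)))
  set w : ℝ := ((stepWt 4 L)⁻¹) ^ (j + 1) with hw
  have hw0 : 0 < w := pow_pos (inv_pos.mpr (stepWt_pos (d := 4) L hL1)) _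
  refine ⟨w * C, by positivity, ?_⟩
  filter_upwards [hfib] with V hV hVu hVP
  obtain ⟨Φ, -, hadm, hact⟩ := hV hVu hVP
  have hex : ∃ U : Site 4 → Fin 4 → (Matrix n n ℂ)ˣ, IsMinimiser 4 (sfClass 4 L N ε) L N (j + 1) V U :=
    exists_isMinimiser_of_nonempty (d := 4) (n := n) hL hε.le hε1 hε2 ⟨_, hadm⟩
  obtain ⟨U, hU⟩ := hex
  refine ⟨⟨U, hU⟩, ?_⟩
  rw [hU.minAct_eq, hUs.minAct_eq]
  have h1 := hU.le _ hadm
  have h2 : fineAction (chart (ContinuousLinearMap.id ℝ (Matrix n n ℂ)) (L * tower L N j) Us (Φ : TDir 4 n (L * tower L N j))) (perWin 4 (N * L ^ (j + 1)))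
      ≤ fineAction Us (perWin 4 (N * L ^ (j + 1))) + C * ‖skewPR N (relLog N V₀ V)‖ := by
    have h := (abs_sub_le_iff.mp hact).1
    linarith
  unfold levelAction at h1 ⊢
  have h3 := mul_le_mul_of_nonneg_left h2 hw0.le
  rw [← hw] at h1 ⊢
  calc w * fineAction U (perWin 4 (N * L ^ (j + 1)))
      ≤ w * fineAction (chart (ContinuousLinearMap.id ℝ (Matrix n n ℂ)) (L * tower L N j) Us (Φ : TDir 4 n (L * tower L N j))) (perWin 4 (N * L ^ (j + 1))) := h1
    _ ≤ w * (fineAction Us (perWin 4 (N * L ^ (j + 1))) + C * ‖skewPR N (relLog N V₀ V)‖) := h3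
    _ = w * fineAction Us (perWin 4 (N * L ^ (j + 1))) + w * C * ‖skewPR N (relLog N V₀ V)‖ := by ring

end

end Summit.QuantumFields.BalabanUV.T4Continuum.NE7MinimalActionUpperLipschitz
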